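import Summits.ValiantsHypothesis.ValiantsHypothesis.Theses.LacunarySymmetroid
import Summits.ValiantsHypothesis.ValiantsHypothesis.Theorems.LacunarySymmetroidMatrixDescartesCensusTropicalKLaw
import Summits.ValiantsHypothesis.ValiantsHypothesis.Theorems.LacunarySymmetroidMatrixDescartesCensusKLawBridge
import Summits.ValiantsHypothesis.ValiantsHypothesis.Theorems.LacunarySymmetroidMatrixDescartesCensusFrame

/-!
# `MatrixDescartes` — census vocabulary, tropical side (part 2 of 2): the implication square between the laws

HONEST FRAMING.  Companion of `…CensusTropicalKLaw` (part 1: the statements `TropRootLawAt`, `TropKPlusLogSqLaw`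
(TB), `TropExponentLaw e` (TE, dead on paper), `TropK4Law e`, `TropicalLifting` (LIFT), and the THIN TROPICAL LAW),
split off only for the 400-line rule; same namespace `…LacunarySymmetroidMatrixDescartes.TropicalCensus`.  Landed as a
HELPER of the crux `Summit.ValiantsHypothesis.ValiantsHypothesis.Theses.LacunarySymmetroid.MatrixDescartes` (ledger
item `stmt-ValiantsHypothesis-18050`, route `LacunarySymmetroid`; object-search cell `pub-symmetroid`, Conjecture-B
ideation seat conjb-2, 2026-08-25) with NO closure claim: every theorem here is an IMPLICATION between statements that
are all OPEN (or, for TE, dead on paper); nothing asserts `KPlusLogSqLaw`, `MatrixDescartes` or anything about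
`VP ≠ VNP`.

Contents (all PROVED): `pow_le_two_pow_logsq`, `log_two_double_le`, `realRootLawAt_zero` (bookkeeping);
`tropKPlusLogSqLaw_of_tropExponentLaw` (TE ⇒ TB); `tropK4Law_of_tropExponentLaw`;
`not_tropicalMonster_of_tropKPlusLogSqLaw` (TB ⇒ ¬`TropicalMonster`, the tropical door to `¬ MatrixDescartes` being the
tree theorem `MatrixDescartes_false_of_TropicalMonster`); `kPlusLogSqLaw_of_lifting_of_tropExponentLaw` (LIFT ∧ TE ⇒ B);
`tropKPlusLogSqLaw_of_kPlusLogSqLaw` (B ⇒ TB, via patchworking `le_card_posRoots_patch` + the symmetric doubling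
`card_roots_SD`); `kPlusLogSqLaw_of_lifting_of_tropKPlusLogSqLaw` (LIFT ∧ TB ⇒ B — the deciding chain of the cell's
Conjecture-B route «KPlusLogSqLaw» (D-0059) is this theorem followed by `Census.matrixDescartes_of_kPlusLogSqLaw`);
`kPlusLogSqLaw_iff_trop_of_lifting` (**given LIFT, B ⇔ TB**); the summaries `conjB_square` / `conjB_square'`.
-/

-- `Summit.ValiantsHypothesis.ValiantsHypothesis.…` repeats a component by the D-0017 layout
-- (single-conjunct summit), which the `dupNamespace` linter flags; the name is mandated.
set_option linter.dupNamespace false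
set_option autoImplicit false

namespace Summit.ValiantsHypothesis.ValiantsHypothesis.Theorems.LacunarySymmetroidMatrixDescartes.TropicalCensus

open Summit.ValiantsHypothesis.ValiantsHypothesis.Theorems.MatrixDescartes.Negative
open Summit.ValiantsHypothesis.ValiantsHypothesis.Theorems.LacunarySymmetroidMatrixDescartes
open scoped BigOperators
open Finset

/-! ## 3. Bridges between the candidate laws (implications only) -/

/-- `m ^ e ≤ 2 ^ (2 e (log₂ m)²)` away from `m ≤ 1`, and the corner: a crude size bookkeeping. [folklore] -/
theorem pow_le_two_pow_logsq (m e : ℕ) : m ^ e ≤ 2 ^ (2 * e * Nat.log 2 m ^ 2 + e) := by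
  rcases Nat.lt_or_ge m 2 with hm | hm
  · -- m ≤ 1
    calc m ^ e ≤ 1 ^ e := Nat.pow_le_pow_left (by omega) e
      _ = 1 := one_pow e
      _ ≤ 2 ^ (2 * e * Nat.log 2 m ^ 2 + e) := Nat.one_le_two_pow
  · have hL : 1 ≤ Nat.log 2 m := Nat.le_log_of_pow_le one_lt_two (by simpa using hm)
    have hlt : m < 2 ^ (Nat.log 2 m + 1) := Nat.lt_pow_succ_log_self one_lt_two m
    have h1 : m ^ e ≤ (2 ^ (Nat.log 2 m + 1)) ^ e := Nat.pow_le_pow_left hlt.le e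
    have h2 : (Nat.log 2 m + 1) * e ≤ 2 * e * Nat.log 2 m ^ 2 + e := by
      have : Nat.log 2 m ≤ Nat.log 2 m ^ 2 := by nlinarith
      nlinarith
    calc m ^ e ≤ (2 ^ (Nat.log 2 m + 1)) ^ e := h1
      _ = 2 ^ ((Nat.log 2 m + 1) * e) := by rw [← pow_mul]
      _ ≤ 2 ^ (2 * e * Nat.log 2 m ^ 2 + e) := Nat.pow_le_pow_right (by norm_num) h2

/-- **TE ⇒ TB.** A uniform exponent law implies tropical Conjecture B (`e·log m + C·K ≤ C'·(K + log² m)` away from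
the `K = 0` corner, which is `tropRootLawAt_zero`). [folklore] -/
theorem tropKPlusLogSqLaw_of_tropExponentLaw {e : ℕ} (h : TropExponentLaw e) : TropKPlusLogSqLaw := by
  obtain ⟨C, hC⟩ := h
  refine ⟨C + 3 * e, fun m K => ?_⟩
  rcases Nat.eq_zero_or_pos K with hK | hK
  · subst hK; exact tropRootLawAt_zero m _
  · apply tropRootLawAt_mono _ (hC m K)
    have h1 := pow_le_two_pow_logsq m e
    calc 2 ^ (C * K) * m ^ e ≤ 2 ^ (C * K) * 2 ^ (2 * e * Nat.log 2 m ^ 2 + e) := Nat.mul_le_mul_left _ h1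
      _ = 2 ^ (C * K + (2 * e * Nat.log 2 m ^ 2 + e)) := by rw [← pow_add]
      _ ≤ 2 ^ ((C + 3 * e) * (K + Nat.log 2 m ^ 2)) := by
          apply Nat.pow_le_pow_right (by norm_num)
          have : e ≤ e * K := Nat.le_mul_of_pos_right e hK
          nlinarith

/-- **The `K = 4` rung in TE currency**: `TropExponentLaw e → TropK4Law e`. [folklore] -/
theorem tropK4Law_of_tropExponentLaw {e : ℕ} (h : TropExponentLaw e) : TropK4Law e := by
  obtain ⟨C, hC⟩ := h
  refine ⟨2 ^ (C * 4), fun m => tropRootLawAt_mono ?_ (hC m 4)⟩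
  exact Nat.mul_le_mul_left _ (Nat.pow_le_pow_left (Nat.le_succ m) e)

/-- **TB ⇒ no tropical monster.**  Tropical Conjecture B closes the tropical door to `¬ MatrixDescartes`
(the door itself is the tree theorem `MatrixDescartes_false_of_TropicalMonster`). [folklore] -/
theorem not_tropicalMonster_of_tropKPlusLogSqLaw (h : TropKPlusLogSqLaw) : ¬ TropicalMonster := by
  obtain ⟨C, hC⟩ := h
  rintro ⟨c, q, hq, hM⟩
  -- eventually `q·C·(K + (log K + c)^{2c}) ≤ K log K`
  obtain ⟨K₁, hK₁⟩ := StubArith4.exp_le (2 * c) (2 * q * C)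
  obtain ⟨K, m, hK, hm, d, v, ε, B, θ, p, hε, hθ, hdom, halt, hbig⟩ := hM (max K₁ (2 ^ (2 * q * C)))
  have hK1 : K₁ ≤ K := le_of_max_le_left hK
  have hK2 : 2 ^ (2 * q * C) ≤ K := le_of_max_le_right hK
  have hL : 2 * q * C ≤ Nat.log 2 K := Nat.le_log_of_pow_le one_lt_two hK2
  have hlogm : Nat.log 2 m ≤ (Nat.log 2 K + c) ^ c :=
    calc Nat.log 2 m ≤ Nat.log 2 (2 ^ ((Nat.log 2 K + c) ^ c)) := Nat.log_mono_right hm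
      _ = (Nat.log 2 K + c) ^ c := Nat.log_pow one_lt_two _
  have hsq : Nat.log 2 m ^ 2 ≤ (Nat.log 2 K + 2 * c) ^ (2 * c) :=
    calc Nat.log 2 m ^ 2 ≤ ((Nat.log 2 K + c) ^ c) ^ 2 := Nat.pow_le_pow_left hlogm 2
      _ = (Nat.log 2 K + c) ^ (2 * c) := by rw [← pow_mul, mul_comm]
      _ ≤ (Nat.log 2 K + 2 * c) ^ (2 * c) := Nat.pow_le_pow_left (by omega) _
  have hB : B ≤ 2 ^ (C * (K + Nat.log 2 m ^ 2)) := hC m K d v ε B θ p hε hθ hdom halt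
  have h1 : 2 * q * C * (Nat.log 2 K + 2 * c) ^ (2 * c) ≤ K * Nat.log 2 K := hK₁ K hK1
  have h2 : 2 * q * C * K ≤ K * Nat.log 2 K :=
    calc 2 * q * C * K = K * (2 * q * C) := by ring
      _ ≤ K * Nat.log 2 K := Nat.mul_le_mul_left K hL
  have h3 : q * C * Nat.log 2 m ^ 2 ≤ q * C * (Nat.log 2 K + 2 * c) ^ (2 * c) := Nat.mul_le_mul_left _ hsq
  have hexp : q * (C * (K + Nat.log 2 m ^ 2)) ≤ K * Nat.log 2 K := by
    have e1 : q * (C * (K + Nat.log 2 m ^ 2)) = q * C * K + q * C * Nat.log 2 m ^ 2 := by ring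
    have e2 : 2 * q * C * (Nat.log 2 K + 2 * c) ^ (2 * c) = 2 * (q * C * (Nat.log 2 K + 2 * c) ^ (2 * c)) := by
      ring
    have e3 : 2 * q * C * K = 2 * (q * C * K) := by ring
    rw [e2] at h1
    rw [e3] at h2
    omega
  have : B ^ q ≤ 2 ^ (K * Nat.log 2 K) :=
    calc B ^ q ≤ (2 ^ (C * (K + Nat.log 2 m ^ 2))) ^ q := Nat.pow_le_pow_left hB q
      _ = 2 ^ (q * (C * (K + Nat.log 2 m ^ 2))) := by rw [← pow_mul, mul_comm]
      _ ≤ 2 ^ (K * Nat.log 2 K) := Nat.pow_le_pow_right (by norm_num) hexp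
  omega

/-- the `K = 0` corner of the real row: no term, no zero. [folklore] -/
theorem realRootLawAt_zero (m B : ℕ) : RealRootLawAt m 0 B := by
  intro d S _
  have h0 : (∑ l : Fin 0, ((Polynomial.X : Polynomial ℝ) ^ d l) • (S l).map Polynomial.C) = 0 := by simp
  rw [h0]
  rcases Nat.eq_zero_or_pos m with hm | hm
  · subst hm
    simp [Matrix.det_isEmpty]
  · haveI : Nonempty (Fin m) := ⟨⟨0, hm⟩⟩
    simp [Matrix.det_zero]

/-- **LIFT ∧ TE ⇒ B.**  The conjunct split of Conjecture B into a tropical half and a lifting half. [folklore] -/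
theorem kPlusLogSqLaw_of_lifting_of_tropExponentLaw {e : ℕ} (hL : TropicalLifting) (hT : TropExponentLaw e) :
    KPlusLogSqLaw := by
  obtain ⟨C, hC⟩ := hL
  obtain ⟨C', hC'⟩ := hT
  refine ⟨C + C' + 3 * e + 1, fun m K => ?_⟩
  rcases Nat.eq_zero_or_pos K with hK | hK
  · subst hK; exact realRootLawAt_zero m _
  · have h := hC m K _ (hC' m K)
    apply Census.realRootLawAt_mono _ h
    have h1 := pow_le_two_pow_logsq m e
    have h2 : 2 ^ (C' * K) * m ^ e + 1 ≤ 2 ^ (C' * K + (2 * e * Nat.log 2 m ^ 2 + e) + 1) := by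
      have : 2 ^ (C' * K) * m ^ e ≤ 2 ^ (C' * K + (2 * e * Nat.log 2 m ^ 2 + e)) := by
        rw [pow_add]; exact Nat.mul_le_mul_left _ h1
      have h1' : 1 ≤ 2 ^ (C' * K + (2 * e * Nat.log 2 m ^ 2 + e)) := Nat.one_le_two_pow
      rw [pow_succ]; omega
    calc 2 ^ (C * K) * (2 ^ (C' * K) * m ^ e + 1)
        ≤ 2 ^ (C * K) * 2 ^ (C' * K + (2 * e * Nat.log 2 m ^ 2 + e) + 1) := Nat.mul_le_mul_left _ h2
      _ = 2 ^ (C * K + (C' * K + (2 * e * Nat.log 2 m ^ 2 + e) + 1)) := by rw [← pow_add]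
      _ ≤ 2 ^ ((C + C' + 3 * e + 1) * (K + Nat.log 2 m ^ 2)) := by
          apply Nat.pow_le_pow_right (by norm_num)
          have : e + 1 ≤ (e + 1) * K := Nat.le_mul_of_pos_right _ hK
          nlinarith

/-- `log₂ (m + m) ≤ log₂ m + 1` [folklore] -/
theorem log_two_double_le (m : ℕ) : Nat.log 2 (m + m) ≤ Nat.log 2 m + 1 := by
  rcases Nat.eq_zero_or_pos m with hm | hm
  · subst hm; simp
  · have : m + m = m * 2 := by ring
    rw [this, Nat.log_mul_base one_lt_two hm.ne']

/-- **B ⇒ TB.**  Conjecture B implies tropical Conjecture B: a design with `n` alternating breakpoints patchworks to a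
general `m × m` pencil with `≥ n` distinct positive zeros (`le_card_posRoots_patch`), whose symmetric doubling
(`card_roots_SD`, format `(m+m, K+1)`) has the same distinct real zeros; so refuting TB (a `TropicalMonster`-type
construction at ONE format suffices) refutes B. [folklore] -/
theorem tropKPlusLogSqLaw_of_kPlusLogSqLaw (h : KPlusLogSqLaw) : TropKPlusLogSqLaw := by
  obtain ⟨C, hC⟩ := h
  refine ⟨6 * C, fun m K => ?_⟩
  rcases Nat.eq_zero_or_pos K with hK | hK
  · subst hK; exact tropRootLawAt_zero m _
  intro d v ε n θ p hε hθ hdom halt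
  obtain ⟨T, hT⟩ := le_card_posRoots_patch d v ε hε θ hθ p hdom halt
  -- the doubled symmetric pencil of format (m+m, K+1)
  have hrow := hC (m + m) (K + 1) (dD d) (SD T) (SD_isSymm T)
  rw [card_roots_SD] at hrow
  have hn : n ≤ 2 ^ (C * (K + 1 + Nat.log 2 (m + m) ^ 2)) :=
    hT.trans ((Finset.card_filter_le _ _).trans hrow)
  apply hn.trans
  apply Nat.pow_le_pow_right (by norm_num)
  have hl := log_two_double_le m
  have h1 : Nat.log 2 (m + m) ^ 2 ≤ (Nat.log 2 m + 1) ^ 2 := Nat.pow_le_pow_left hl 2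
  have h2 : (Nat.log 2 m + 1) ^ 2 ≤ 3 * Nat.log 2 m ^ 2 + 1 + 2 * K := by nlinarith
  nlinarith

/-- **LIFT ∧ TB ⇒ B.**  The conjunct split of record (v2): tropical Conjecture B plus format-level lifting give
Conjecture B (`2^{CK} · (2^{C'(K + log² m)} + 1) ≤ 2^{(C + C' + 1)(K + log² m)}` for `K ≥ 1`; `K = 0` is the empty corner). [folklore] -/
theorem kPlusLogSqLaw_of_lifting_of_tropKPlusLogSqLaw (hL : TropicalLifting) (hT : TropKPlusLogSqLaw) :
    KPlusLogSqLaw := by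
  obtain ⟨C, hC⟩ := hL
  obtain ⟨C', hC'⟩ := hT
  refine ⟨C + C' + 1, fun m K => ?_⟩
  rcases Nat.eq_zero_or_pos K with hK | hK
  · subst hK; exact realRootLawAt_zero m _
  · have h := hC m K _ (hC' m K)
    apply Census.realRootLawAt_mono _ h
    have key : ∀ E : ℕ, 2 ^ E + 1 ≤ 2 ^ (E + 1) := fun E => by
      have := Nat.one_le_two_pow (n := E)
      rw [Nat.pow_succ]; omega
    have h2 : 2 ^ (C' * (K + Nat.log 2 m ^ 2)) + 1 ≤ 2 ^ (C' * (K + Nat.log 2 m ^ 2) + 1) := key _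
    calc 2 ^ (C * K) * (2 ^ (C' * (K + Nat.log 2 m ^ 2)) + 1)
        ≤ 2 ^ (C * K) * 2 ^ (C' * (K + Nat.log 2 m ^ 2) + 1) := Nat.mul_le_mul_left _ h2
      _ = 2 ^ (C * K + (C' * (K + Nat.log 2 m ^ 2) + 1)) := by rw [← pow_add]
      _ ≤ 2 ^ ((C + C' + 1) * (K + Nat.log 2 m ^ 2)) := by
          apply Nat.pow_le_pow_right (by norm_num)
          nlinarith

/-- **Given LIFT, Conjecture B is a purely tropical statement: B ⇔ TB.** [folklore] -/
theorem kPlusLogSqLaw_iff_trop_of_lifting (hL : TropicalLifting) : KPlusLogSqLaw ↔ TropKPlusLogSqLaw :=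
  ⟨tropKPlusLogSqLaw_of_kPlusLogSqLaw, kPlusLogSqLaw_of_lifting_of_tropKPlusLogSqLaw hL⟩

/-- Summary of the square of implications (all proved above / in the tree):
`LIFT ∧ TE ⇒ B ⇒ TB ⇒ ¬TropicalMonster`, `TE ⇒ TB`, `B ⇒ MatrixDescartes` (tree), `TropicalMonster ⇒ ¬MatrixDescartes` (tree).
(v2: TE is dead; the live split is `conjB_square'`.) [folklore] -/
theorem conjB_square {e : ℕ} :
    (TropicalLifting ∧ TropExponentLaw e → KPlusLogSqLaw) ∧ (KPlusLogSqLaw → TropKPlusLogSqLaw) ∧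
      (TropExponentLaw e → TropKPlusLogSqLaw) ∧ (TropKPlusLogSqLaw → ¬ TropicalMonster) ∧
      (KPlusLogSqLaw → Summit.ValiantsHypothesis.ValiantsHypothesis.Theses.LacunarySymmetroid.MatrixDescartes) :=
  ⟨fun h => kPlusLogSqLaw_of_lifting_of_tropExponentLaw h.1 h.2, tropKPlusLogSqLaw_of_kPlusLogSqLaw,
    tropKPlusLogSqLaw_of_tropExponentLaw, not_tropicalMonster_of_tropKPlusLogSqLaw,
    Census.matrixDescartes_of_kPlusLogSqLaw⟩

/-- **The square of record (v2).**  `LIFT ∧ TB ⇒ B`, `B ⇒ TB`, `TB ⇒ ¬TropicalMonster`, `B ⇒ MatrixDescartes` (tree):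
under LIFT the real law B and the tropical law TB are equivalent, and TB alone already closes the tropical door. [folklore] -/
theorem conjB_square' :
    (TropicalLifting ∧ TropKPlusLogSqLaw → KPlusLogSqLaw) ∧ (KPlusLogSqLaw → TropKPlusLogSqLaw) ∧
      (TropicalLifting → (KPlusLogSqLaw ↔ TropKPlusLogSqLaw)) ∧ (TropKPlusLogSqLaw → ¬ TropicalMonster) ∧
      (KPlusLogSqLaw → Summit.ValiantsHypothesis.ValiantsHypothesis.Theses.LacunarySymmetroid.MatrixDescartes) :=
  ⟨fun h => kPlusLogSqLaw_of_lifting_of_tropKPlusLogSqLaw h.1 h.2, tropKPlusLogSqLaw_of_kPlusLogSqLaw,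
    kPlusLogSqLaw_iff_trop_of_lifting, not_tropicalMonster_of_tropKPlusLogSqLaw,
    Census.matrixDescartes_of_kPlusLogSqLaw⟩

end Summit.ValiantsHypothesis.ValiantsHypothesis.Theorems.LacunarySymmetroidMatrixDescartes.TropicalCensus
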